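import Literature.AlgebraicGeometry.Hironaka2017.Proofs.S06BaseHike.CrossSpecimenEdge
import Literature.AlgebraicGeometry.Hironaka2017.Proofs.S06BaseHike.Thm614Part1CrossNegative
import Literature.AlgebraicGeometry.Resolution.NodalPowRingSingularLocus
import Literature.AlgebraicGeometry.Resolution.RegularLocalRingsQuotient
import Literature.AlgebraicGeometry.Resolution.SubschemeRegularStalks
import Summits.ResolutionOfSingularities.ResolutionOfSingularities.Theorems.MarkedTransferCampaignW31UscHolds
import Summits.ResolutionOfSingularities.ResolutionOfSingularities.Theorems.MarkedTransferCampaignW31RegularCut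
import Mathlib.FieldTheory.IsAlgClosed.AlgebraicClosure
import HarnessLib

/-!
# [OURS · L1 W3.6, G3 SEAT 1] THE CROSS SPECIMEN — a STANDARD `E` on `𝔸³` whose `Σ̄_max(Ê)` is the SINGULAR l.c.i. cut
# `C = V(z,x) ∪ V(z,y)`: the class guard `LCIClass` holds and W3.1's `InvmaxClosureRegularOn` FAILS, the typed `Ě` exists by the
# W3.6 door `campaignW36CoreFocusExists_lci_holds`, and the typed Th. 6.14 (1) (`Thm6_14_1`, row 040a, readings R1) fails for
# EVERY typed core focus `Ě` of `Ê`

Cell `res-hironaka`, rung L, G3 SEAT 1 (label res-L1-s36-pv-3, seat res-D-pv-034; res-adj-3 (B) 2026-08-27T04:29:39Z): «certify ONE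
standard `Ê` over a perfect `K` whose `Σ̄_max` is a SINGULAR l.c.i. cut, obtain its typed `Ě` from `campaignW36CoreFocusExists_lci_holds`,
and prove `¬ Thm6_14_1` (typed) at the cross point for EVERY typed core focus of that `Ê`». Consumers R20/20a, R99/99a, R12; desk #98
(E2.iii) inhabitant. HOST item stmt-ResolutionOfSingularities-16155 via `--supports` (as every W3.x campaign file).

HONEST FRAMING (D-0012/D-0089). Everything here is OURS: kernel theorems about the campaign's TYPED carriers (rows 003/004/005/007/
010d/040a of the Hironaka-2017 typing, res-type-010's `diffPower`, o4's classes `CampaignW36.IsLCICutAt`/`LCIClass` p488503, W3.1's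
`CampaignW31.InvmaxClosureRegularOn` p476257, the W3.6 door p494780/`campaignW36CoreFocusExists_lci_holds`) at ONE located datum.
H. Hironaka's manuscript (ms. 2017-03-23, lit key `paper:url-3343fd9e678b`) is unrefereed and UNDER ADJUDICATION; nothing printed
in it is asserted or used as a premise. AI-produced kernel proofs with standard axioms; weaker than expert review.

THE DATUM (Literature `Proofs/S06BaseHike/CrossSpecimen*.lean`, this seat). `K` algebraically closed of characteristic `2`
(e.g. `K = 𝔽̄₂`, last `example`), `Z = Spec K[z,y,x] = 𝔸³`, `E_× = ((z² + x³y³)·𝒪_Z, 2)` (standard, `Ê_× = baseHike E_× = E_×`),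
`Sing(Ê_×) = C = V(z,x) ∪ V(z,y)` — two lines crossing at the origin.

WHAT THIS FILE PROVES.
* Part A — `C` is an l.c.i. cut at EVERY point (closed or not): `(z,x) ⊓ (z,y) = (z, xy)` (`inf_pS_eq_span`), `(𝓘_C)_P = (z, xy)·𝒪_P`
  (`stalkIdeal_vanishingIdeal_C`), `(z, xy)` is `𝒪_P`-regular (`isRegular_pair`: `𝒪_P` a domain, `z·𝒪_P` prime, `z ∤ xy`), hence
  o4's `IsLCICutAt C P` (`isLCICutAt_C`).
* Part B — `C` is SINGULAR at the origin: `𝒪_{Z,0} ⧸ (𝓘_C)_0 ≅ (𝒪/(z))/(xy)` with `𝒪/(z)` regular (Matsumura 14.2, tree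
  `IsRegularLocalRing.quotient_span_singleton`) and `xy` a non-zero element of its `𝔪²` (tree
  `not_isRegularLocalRing_quotient_span_singleton_of_mem_sq'`): `not_isRegularLocalRing_quotient_origin`.
* Part C — for EVERY certified (Def. 4.9, reading `CampaignW31.edgeDataProvenance`) edge-data family `ed` of `Ê_×` on `Sing(Ê_×)_cl`
  (one exists: `exists_isEdgeDataOn_baseHike_EX`, from part 3c's `edgeDataOn_of_eq`; `Inv ≡ (3,2,2)` so `Σ_max = Sing(Ê_×)_cl` and
  `Σ̄_max = C`, `invmaxClosure_eq_C`): the class guard `LCIClass Ê_× Σ_max` (`lciClass_baseHike_EX`), NOT W3.1-regular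
  (`not_invmaxClosureRegularOn_baseHike_EX`, via tree `Scheme.isRegular_subscheme_iff`), the typed `Ě` EXISTS
  (`exists_isCoreFocus_baseHike_EX` = the door applied), and `¬ Thm6_14_1` for EVERY typed core focus `Ě`, every `n`, every
  `IsCoreFocusOf`/standard `E`, every reading `IsEdgeData' ⇒ IsEdgeData` (`not_Thm6_14_1_of_isCoreFocus_baseHike_EX`,
  `not_Thm6_14_1_EX`; this seat's Literature `Thm614Part1CrossNegative.not_Thm6_14_1_of_isCoreFocus`: `r = 1` at the cross point,
  `r = 2` at the closed branch points of every neighbourhood). Packaged: `crossSpecimen_inhabitant`.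

## References (context; nothing below is used as a premise)
* H. Matsumura, Commutative Ring Theory (1987), Thm. 14.2. [cite: Matsumura1987, Thm. 14.2]
* H. Hironaka, ms. 2017-03-23, Def. 4.9 p.20, Eq. (34) p.24, Eq. (43) p.30, Th. 6.14 (1) p.34 — scope only, under adjudication. [Hironaka2017]
* Cell records: res-adj-3 (B) SEAT 1 04:29:39Z; res-plan-2 MAP v1.4 04:30:12Z; o4 p488503; W3.1 p476257; door `MarkedTransferCampaignW31UscHolds`.
-/

noncomputable section

set_option linter.dupNamespace false -- mandated namespace of this single-conjunct summit

open _root_.AlgebraicGeometry _root_.TopologicalSpace _root_.CategoryTheory _root_.IsLocalRing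

namespace Summit.ResolutionOfSingularities.ResolutionOfSingularities.Theorems

namespace CrossSpecimenW36

open Literature.AlgebraicGeometry.Resolution Scheme.IdealSheafData
open Literature.AlgebraicGeometry.Hironaka2017
open Literature.AlgebraicGeometry.Hironaka2017.S02Preliminaries
open Literature.AlgebraicGeometry.Hironaka2017.S04CharAlgebra
open Literature.AlgebraicGeometry.Hironaka2017.S06BaseHike
open Literature.AlgebraicGeometry.Hironaka2017.SpecOrders
open Literature.AlgebraicGeometry.Hironaka2017.CoordArrangement
open Literature.AlgebraicGeometry.Hironaka2017.S06BaseHike.SpecimenA (R Z hom ambient)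
open Literature.AlgebraicGeometry.Hironaka2017.SpanXValuation
open Literature.AlgebraicGeometry.Hironaka2017.S06BaseHike.CrossSpecimen
open scoped Pointwise

variable (K : Type) [Field K]

/-! ## Part A — `C = V(z,x) ∪ V(z,y)` is an l.c.i. cut at EVERY point: `(𝓘_C)_P = (z, xy)·𝒪_P` with `(z, xy)` regular -/

/-- `(z,x) ⊓ (z,y) = (z, xy)` in `K[z,y,x]` (monomial ideals). -/
theorem inf_pS_eq_span :
    pS (K := K) CrossSpecimen.S 0 ⊓ pS (K := K) CrossSpecimen.S 1 =
      Ideal.span {(MvPolynomial.X 0 : R K), MvPolynomial.X 2 * MvPolynomial.X 1} := by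
  apply le_antisymm
  · intro q hq
    rw [Ideal.mem_inf, pS, pS, S_zero, S_one, MvPolynomial.mem_ideal_span_X_image,
      MvPolynomial.mem_ideal_span_X_image] at hq
    rw [MvPolynomial.as_sum q]
    refine Ideal.sum_mem _ fun m hm => ?_
    obtain ⟨i, hi, hmi⟩ := hq.1 m hm
    obtain ⟨j, hj, hmj⟩ := hq.2 m hm
    simp only [Set.mem_insert_iff, Set.mem_singleton_iff] at hi hj
    by_cases h0 : m 0 ≠ 0
    · -- `z ∣ monomial m`
      have h : (MvPolynomial.monomial m (q.coeff m) : R K) =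
          MvPolynomial.X 0 * MvPolynomial.monomial (m - Finsupp.single 0 1) (q.coeff m) := by
        rw [MvPolynomial.X, MvPolynomial.monomial_mul, one_mul,
          add_tsub_cancel_of_le (Finsupp.single_le_iff.mpr (Nat.one_le_iff_ne_zero.mpr h0))]
      rw [h]
      exact Ideal.mul_mem_right _ _ (Ideal.subset_span (by simp))
    · have hi2 : m 2 ≠ 0 := by rcases hi with rfl | rfl; exacts [absurd hmi h0, hmi]
      have hj1 : m 1 ≠ 0 := by rcases hj with rfl | rfl; exacts [absurd hmj h0, hmj]
      have hle : Finsupp.single (2 : Fin 3) 1 + Finsupp.single 1 1 ≤ m := by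
        intro k
        fin_cases k
        · simp
        · simpa [Finsupp.add_apply, Finsupp.single_apply] using Nat.one_le_iff_ne_zero.mpr hj1
        · simpa [Finsupp.add_apply, Finsupp.single_apply] using Nat.one_le_iff_ne_zero.mpr hi2
      have h : (MvPolynomial.monomial m (q.coeff m) : R K) =
          (MvPolynomial.X 2 * MvPolynomial.X 1) *
            MvPolynomial.monomial (m - (Finsupp.single 2 1 + Finsupp.single 1 1)) (q.coeff m) := by
        rw [MvPolynomial.X, MvPolynomial.X, MvPolynomial.monomial_mul, MvPolynomial.monomial_mul, one_mul, one_mul,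
          add_tsub_cancel_of_le hle]
      rw [h]
      exact Ideal.mul_mem_right _ _ (Ideal.subset_span (by simp))
  · rw [Ideal.span_le]
    intro q hq
    simp only [Set.mem_insert_iff, Set.mem_singleton_iff] at hq
    rcases hq with rfl | rfl
    · exact ⟨Ideal.subset_span ⟨0, by simp [S_zero], rfl⟩, Ideal.subset_span ⟨0, by simp [S_one], rfl⟩⟩
    · exact ⟨Ideal.mul_mem_right _ _ (Ideal.subset_span ⟨2, by simp [S_zero], rfl⟩),
        Ideal.mul_mem_left _ _ (Ideal.subset_span ⟨1, by simp [S_one], rfl⟩)⟩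

/-- **`(𝓘_C)_P = (z, xy)·𝒪_{Z,P}` at EVERY point `P` of `𝔸³`** (closed or not). -/
theorem stalkIdeal_vanishingIdeal_C (P : Z K) :
    stalkIdeal (vanishingIdeal (CrossSpecimen.C K)) P =
      Ideal.ofList [gm P (MvPolynomial.X 0), gm P (MvPolynomial.X 2 * MvPolynomial.X 1)] := by
  rw [← diffPower_one, stalkIdeal_diffPower_C, pow_one, pow_one, inf_pS_eq_span, Ideal.map_span,
    Set.image_insert_eq, Set.image_singleton]
  ext q
  simp only [Ideal.ofList, List.mem_cons, List.mem_nil_iff, or_false]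
  rfl

/-- **`z·𝒪_{Z,P}` is prime and lies over `(z)`**: for `z ∈ 𝔓_P` and `z ∤ w` in `K[z,y,x]`, `germ w ∉ (germ z)`. -/
theorem isPrime_span_germ_X0_and_not_mem (P : Z K) (hz : (MvPolynomial.X 0 : R K) ∈ P.asIdeal) {w : R K}
    (hw' : w ∉ Ideal.span {(MvPolynomial.X 0 : R K)}) :
    (Ideal.span {gm P (MvPolynomial.X 0)}).IsPrime ∧ gm P w ∉ Ideal.span {gm P (MvPolynomial.X 0)} := by
  have hpz : (Ideal.span {(MvPolynomial.X 0 : R K)}).IsPrime := by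
    have h := isPrime_span_X (K := K) ({0} : Set (Fin 3))
    rwa [Set.image_singleton] at h
  have hdisj : Disjoint (P.asIdeal.primeCompl : Set (R K)) (Ideal.span {(MvPolynomial.X 0 : R K)} : Set (R K)) :=
    Set.disjoint_left.mpr fun q hq hq' => hq ((Ideal.span_le.mpr (Set.singleton_subset_iff.mpr hz)) hq')
  rw [show Ideal.span {gm P (MvPolynomial.X 0)} =
      (Ideal.span {(MvPolynomial.X 0 : R K)}).map (algebraMap (R K) (St (R K) P)) by
    rw [Ideal.map_span, Set.image_singleton]]
  refine ⟨IsLocalization.isPrime_of_isPrime_disjoint P.asIdeal.primeCompl _ _ hpz hdisj, fun h => hw' ?_⟩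
  have h' : w ∈ ((Ideal.span {(MvPolynomial.X 0 : R K)}).map (algebraMap (R K) (St (R K) P))).under (R K) := h
  exact (IsLocalization.under_map_of_isPrime_disjoint P.asIdeal.primeCompl (St (R K) P) hpz hdisj).le h'

/-- **`(z, w)` is an `𝒪_{Z,P}`-regular sequence** whenever `z, w ∈ 𝔓_P` and `z ∤ w` in `K[z,y,x]`: `𝒪_P` is a domain, `z·𝒪_P` is
prime, `w ∉ z·𝒪_P`, and `(z, w) ⊆ 𝔪_P`. -/
theorem isRegular_pair (P : Z K) (hz : (MvPolynomial.X 0 : R K) ∈ P.asIdeal) {w : R K} (hw : w ∈ P.asIdeal)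
    (hw' : w ∉ Ideal.span {(MvPolynomial.X 0 : R K)}) :
    RingTheory.Sequence.IsRegular (St (R K) P) [gm P (MvPolynomial.X 0), gm P w] := by
  haveI : IsDomain (St (R K) P) :=
    IsLocalization.isDomain_of_le_nonZeroDivisors (M := P.asIdeal.primeCompl) (St (R K) P)
      (Ideal.primeCompl_le_nonZeroDivisors _)
  have hinj : Function.Injective (algebraMap (R K) (St (R K) P)) :=
    IsLocalization.injective (St (R K) P) (Ideal.primeCompl_le_nonZeroDivisors P.asIdeal)
  obtain ⟨hpz', hwz⟩ := isPrime_span_germ_X0_and_not_mem K P hz hw'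
  -- membership in `r • ⊤`
  have key : ∀ (r x : St (R K) P), x ∈ r • (⊤ : Submodule (St (R K) P) (St (R K) P)) ↔ x ∈ Ideal.span {r} := by
    intro r x
    rw [← Submodule.ideal_span_singleton_smul, smul_eq_mul, Ideal.mul_top]
  refine RingTheory.Sequence.IsRegular.of_isWeaklyRegular_of_mem_maximalIdeal (St (R K) P) ?_ ?_
  · intro r hr
    simp only [List.mem_cons, List.mem_nil_iff, or_false] at hr
    rcases hr with rfl | rfl
    · exact (IsLocalization.AtPrime.to_map_mem_maximal_iff (St (R K) P) P.asIdeal _).mpr hz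
    · exact (IsLocalization.AtPrime.to_map_mem_maximal_iff (St (R K) P) P.asIdeal _).mpr hw
  · rw [RingTheory.Sequence.isWeaklyRegular_cons_iff, RingTheory.Sequence.isWeaklyRegular_singleton_iff]
    refine ⟨?_, ?_⟩
    · have hne : gm P (MvPolynomial.X 0) ≠ 0 := fun h =>
        MvPolynomial.X_ne_zero (0 : Fin 3) (hinj (h.trans (map_zero _).symm))
      exact (IsRegular.of_ne_zero hne).left.isSMulRegular
    · rw [isSMulRegular_quotient_iff_mem_of_smul_mem]
      intro x hx
      rw [key] at hx ⊢
      rw [smul_eq_mul] at hx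
      exact (hpz'.mem_or_mem hx).resolve_left hwz

/-- `xy ∉ (z)`. -/
theorem X2_mul_X1_not_mem_span : (MvPolynomial.X 2 * MvPolynomial.X 1 : R K) ∉ Ideal.span {(MvPolynomial.X 0 : R K)} := by
  rw [Ideal.mem_span_singleton]
  intro h
  have h2 := (MvPolynomial.monomial_dvd_monomial.mp (show (MvPolynomial.monomial (Finsupp.single (0 : Fin 3) 1) (1 : K)) ∣
      MvPolynomial.monomial (Finsupp.single 2 1 + Finsupp.single 1 1) 1 by
    simpa only [MvPolynomial.X, MvPolynomial.monomial_mul, one_mul] using h)).1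
  rcases h2 with h2 | h2
  · exact one_ne_zero h2
  · have := h2 0
    simp [Finsupp.add_apply] at this

/-- **`C` is an l.c.i. cut at EVERY point of `C`** (o4's `CampaignW36.IsLCICutAt`): `(𝓘_C)_P` is generated by the regular sequence
`(z, xy)`. -/
theorem isLCICutAt_C {P : Z K} (hP : P ∈ (CrossSpecimen.C K : Set (Z K))) : CampaignW36.IsLCICutAt (CrossSpecimen.C K) P := by
  have hz : (MvPolynomial.X 0 : R K) ∈ P.asIdeal ∧ (MvPolynomial.X 2 * MvPolynomial.X 1 : R K) ∈ P.asIdeal := by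
    rcases (mem_C_iff K P).mp hP with ⟨h0, h2⟩ | ⟨h0, h1⟩
    · exact ⟨h0, Ideal.mul_mem_right _ _ h2⟩
    · exact ⟨h0, Ideal.mul_mem_left _ _ h1⟩
  exact ⟨_, isRegular_pair K P hz.1 hz.2 (X2_mul_X1_not_mem_span K), (stalkIdeal_vanishingIdeal_C K P).symm⟩

/-! ## Part B — `C` is SINGULAR at the origin: `𝒪_{Z,0} ⧸ (𝓘_C)_0 = 𝒪/(z, xy)` is not a regular local ring -/

/-- `germ z ∉ 𝔪_0²` at the origin (`𝔪_0² ⊆ K[z,y,x]` is `𝔪_0`-primary and `z ∉ 𝔪_0²`). -/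
theorem germ_X0_not_mem_sq_origin :
    gm (CoordChart.origin K (Fin 3)) (MvPolynomial.X 0) ∉
      maximalIdeal (St (R K) (CoordChart.origin K (Fin 3))) ^ 2 := by
  set P := CoordChart.origin K (Fin 3)
  intro h
  rw [maximalIdeal_St, ← Ideal.map_pow] at h
  have hmax : P.asIdeal.IsMaximal := CoordChart.isMaximal_idealOfVars
  have hprim : (P.asIdeal ^ 2).IsPrimary := by
    apply Ideal.isPrimary_of_isMaximal_radical
    rw [Ideal.radical_pow _ (by norm_num), hmax.isPrime.radical]
    exact hmax
  have hdisj : Disjoint (P.asIdeal.primeCompl : Set (R K)) (P.asIdeal ^ 2 : Ideal (R K)) :=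
    Set.disjoint_left.mpr fun q hq hq2 => hq (Ideal.pow_le_self two_ne_zero hq2)
  have h' : (MvPolynomial.X 0 : R K) ∈ ((P.asIdeal ^ 2).map (algebraMap (R K) (St (R K) P))).under (R K) := h
  have hz : (MvPolynomial.X 0 : R K) ∈ MvPolynomial.idealOfVars (Fin 3) K ^ 2 :=
    (IsLocalization.under_map_of_isPrimary_disjoint P.asIdeal.primeCompl (St (R K) P) hprim hdisj).le h'
  rw [MvPolynomial.mem_pow_idealOfVars_iff'] at hz
  have := hz (Finsupp.single 0 1) (by simp)
  rw [MvPolynomial.coeff_X, if_pos rfl] at this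
  exact one_ne_zero this

/-- **`C` is SINGULAR at the origin** [OURS]: `𝒪_{Z,0} ⧸ (𝓘_C)_0` is not regular — `𝒪_{Z,0}/(z)` is a regular local ring
(`z ∈ 𝔪 ∖ 𝔪²`, Matsumura 14.2) in which the image of `xy` is a non-zero element of `𝔪²`, so the hypersurface ring
`(𝒪/(z))/(xy) ≅ 𝒪/(z, xy)` is not regular (embedding dimension `2 >` dimension `1`). -/
theorem not_isRegularLocalRing_quotient_origin (p : ℕ) [Fact p.Prime] [CharP K p] :
    ¬ IsRegularLocalRing (St (R K) (CoordChart.origin K (Fin 3)) ⧸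
        stalkIdeal (vanishingIdeal (CrossSpecimen.C K)) (CoordChart.origin K (Fin 3))) := by
  set P := CoordChart.origin K (Fin 3)
  intro hreg
  have hXP : ∀ i : Fin 3, (MvPolynomial.X i : R K) ∈ P.asIdeal := fun i =>
    show (MvPolynomial.X i : R K) ∈ MvPolynomial.idealOfVars (Fin 3) K from Ideal.subset_span (Set.mem_range_self i)
  have hzP := hXP 0
  have hxP := hXP 2
  have hyP := hXP 1
  haveI : IsRegularLocalRing (St (R K) P) := (isRegularLocalRing_and_spanFinrank K p CoordChart.isClosed_origin).1
  have hzm : gm P (MvPolynomial.X 0) ∈ maximalIdeal (St (R K) P) :=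
    (IsLocalization.AtPrime.to_map_mem_maximal_iff (St (R K) P) P.asIdeal _).mpr hzP
  -- `𝒪/(z)` is regular local
  obtain ⟨hreg1, -⟩ := IsRegularLocalRing.quotient_span_singleton hzm (germ_X0_not_mem_sq_origin K)
  set I₁ : Ideal (St (R K) P) := Ideal.span {gm P (MvPolynomial.X 0)} with hI₁
  haveI : IsRegularLocalRing (St (R K) P ⧸ I₁) := hreg1
  haveI : IsDomain (St (R K) P ⧸ I₁) := isDomain_of_isRegularLocalRing _
  -- the image `b` of `xy`
  set b : St (R K) P ⧸ I₁ := Ideal.Quotient.mk I₁ (gm P (MvPolynomial.X 2 * MvPolynomial.X 1)) with hb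
  have hb0 : b ≠ 0 := by
    rw [hb, Ne, Ideal.Quotient.eq_zero_iff_mem]
    exact (isPrime_span_germ_X0_and_not_mem K P hzP (X2_mul_X1_not_mem_span K)).2
  haveI : Nontrivial (St (R K) P ⧸ I₁) := inferInstance
  have hb2 : b ∈ maximalIdeal (St (R K) P ⧸ I₁) ^ 2 := by
    rw [maximalIdeal_quotient_eq_map I₁, ← Ideal.map_pow, hb]
    refine Ideal.mem_map_of_mem _ ?_
    dsimp only [gm]
    rw [map_mul, pow_two]
    exact Ideal.mul_mem_mul ((IsLocalization.AtPrime.to_map_mem_maximal_iff (St (R K) P) P.asIdeal _).mpr hxP)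
      ((IsLocalization.AtPrime.to_map_mem_maximal_iff (St (R K) P) P.asIdeal _).mpr hyP)
  refine not_isRegularLocalRing_quotient_span_singleton_of_mem_sq' (mem_nonZeroDivisors_of_ne_zero hb0) hb2 ?_
  -- `(𝒪/(z))/(b) ≅ 𝒪/(z, xy) = 𝒪 ⧸ (𝓘_C)_0`
  have h1 : Ideal.span {b} = (Ideal.span {gm P (MvPolynomial.X 2 * MvPolynomial.X 1)}).map (Ideal.Quotient.mk I₁) := by
    rw [Ideal.map_span, Set.image_singleton]
  have h2 : I₁ ⊔ Ideal.span {gm P (MvPolynomial.X 2 * MvPolynomial.X 1)} =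
      stalkIdeal (vanishingIdeal (CrossSpecimen.C K)) P := by
    rw [stalkIdeal_vanishingIdeal_C, hI₁, ← Ideal.span_union, Set.singleton_union]
    congr 1
    ext q
    simp
  have e : (St (R K) P ⧸ I₁) ⧸ Ideal.span {b} ≃+* St (R K) P ⧸ stalkIdeal (vanishingIdeal (CrossSpecimen.C K)) P :=
    (Ideal.quotEquivOfEq h1).trans ((DoubleQuot.quotQuotEquivQuotSup _ _).trans (Ideal.quotEquivOfEq h2))
  exact IsRegularLocalRing.of_ringEquiv e.symm


/-! ## Part C — the class guard `LCIClass`, the door, the typed `Ě`, and `¬ Thm6_14_1` for EVERY typed core focus -/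

section Instance

variable [CharP K 2] [IsAlgClosed K]

/-- **For every certified family `ed` of Def. 4.9 edge data of `Ê_× = baseHike Ê_×` on `Sing(Ê_×)_cl`, the closure of the
`Inv_max`-stratum IS the cross `C`** (as a closed subset; `CrossSpecimenEdge.closure_invmaxStratum_eq_C`). -/
theorem invmaxClosure_eq_C {n : ℕ} (ed : EdgeDataOn 2 n (baseHike (EX K)))
    (hed : IsEdgeDataOn CampaignW31.edgeDataProvenance (baseHike (EX K)) ed) :
    Closeds.closure (invmaxStratum ((baseHike (EX K)).sing ∩ S02Preliminaries.closedPoints (Z K))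
        (invField (baseHike (EX K)) ed)) = CrossSpecimen.C K :=
  Closeds.ext (closure_invmaxStratum_eq_C (baseHike_EX K) ed hed)

/-- **THE CLASS GUARD: `(Ê_×, ed)` lies in o4's A-type class `LCIClass`** for EVERY certified family `ed` — `Σ̄_max = C` and `C`
is an l.c.i. cut at every point (Part A). -/
theorem lciClass_baseHike_EX {n : ℕ} (ed : EdgeDataOn 2 n (baseHike (EX K)))
    (hed : IsEdgeDataOn CampaignW31.edgeDataProvenance (baseHike (EX K)) ed) :
    CampaignW36.LCIClass (baseHike (EX K))
      (invmaxStratum ((baseHike (EX K)).sing ∩ S02Preliminaries.closedPoints (Z K)) (invField (baseHike (EX K)) ed)) := by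
  intro x hx
  rw [invmaxClosure_eq_C K ed hed]
  rw [closure_invmaxStratum_eq_C (baseHike_EX K) ed hed] at hx
  exact isLCICutAt_C K hx

/-- **… and NOT in W3.1's regular class**: `Σ̄_max(Ê_×) = C` is SINGULAR (`¬ CampaignW31.InvmaxClosureRegularOn`), for EVERY
certified family — the reduced structure of `C` has the non-regular stalk `𝒪_{Z,0}/(z, xy)` at the origin (Part B). -/
theorem not_invmaxClosureRegularOn_baseHike_EX {n : ℕ} (ed : EdgeDataOn 2 n (baseHike (EX K)))
    (hed : IsEdgeDataOn CampaignW31.edgeDataProvenance (baseHike (EX K)) ed) :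
    ¬ CampaignW31.InvmaxClosureRegularOn ((baseHike (EX K)).sing ∩ S02Preliminaries.closedPoints (Z K))
        (invField (baseHike (EX K)) ed) := by
  intro hreg
  unfold CampaignW31.InvmaxClosureRegularOn CampaignW31.invmaxClosure at hreg
  rw [invmaxClosure_eq_C K ed hed] at hreg
  haveI : IsNoetherian (Z K) := (ambient K 2).isNoetherian_ambient
  have h := (Scheme.isRegular_subscheme_iff _).mp hreg (CoordChart.origin K (Fin 3))
    (by rw [← SetLike.mem_coe, Scheme.IdealSheafData.coe_support_vanishingIdeal]; exact origin_mem_C K)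
  exact not_isRegularLocalRing_quotient_origin K 2 h

/-- **A certified family EXISTS** (reading R1 = `CampaignW31.edgeDataProvenance`): the Def. 4.9 edge data of part 3c at every closed
point of `Sing(Ê_×) = C` (`r = 1`, `q = (2)`, `Inv ≡ (3, 2, 2)`). -/
theorem exists_isEdgeDataOn_baseHike_EX :
    ∃ ed : EdgeDataOn 2 3 (baseHike (EX K)), IsEdgeDataOn CampaignW31.edgeDataProvenance (baseHike (EX K)) ed :=
  ⟨edgeDataOn_of_eq (baseHike_EX K), isEdgeDataOn_edgeDataOn_of_eq (baseHike_EX K)⟩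

/-- **THE TYPED `Ě` OF `Ê_×` EXISTS** — from the W3.6 door `campaignW36CoreFocusExists_lci_holds` (row 010d's
`∃ Ě, IsCoreFocus ℘ (invInst Ê ed) Ê Ě`), for EVERY certified family `ed`. -/
theorem exists_isCoreFocus_baseHike_EX {n : ℕ} (ed : EdgeDataOn 2 n (baseHike (EX K)))
    (hed : IsEdgeDataOn CampaignW31.edgeDataProvenance (baseHike (EX K)) ed) :
    ∃ Echeck : IdealExponent (Z K), IsCoreFocus S04CharAlgebra.pAlg (invInst (baseHike (EX K)) ed) (baseHike (EX K)) Echeck :=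
  campaignW36CoreFocusExists_lci_holds 2 K (ambient K 2) n (EX K) ed (isStandard_EX K) (baseHike_b_pos K) hed
    (lciClass_baseHike_EX K ed hed)

/-- **`¬ Thm6_14_1` (row 040a, readings R1) FOR EVERY TYPED CORE FOCUS `Ě` OF `Ê_×`**: for every certified family `ed` and every
`Ě` with `IsCoreFocus ℘ (invInst Ê_× ed) Ê_× Ě`, the typed Th. 6.14 (1) fails for `(E, Ě)` whatever the standard `E`, the relation
`IsCoreFocusOf` and the edge-data reading `IsEdgeData' ⇒ IsEdgeData` (`Thm614Part1CrossNegative.not_Thm6_14_1_of_isCoreFocus`: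
`Sing(Ě) = C`, `℘(Ě,a) = 𝓘_C^{⟨a⟩}`, `r = 1` at the cross point vs `r = 2` at the closed branch points of every neighbourhood). -/
theorem not_Thm6_14_1_of_isCoreFocus_baseHike_EX (n : ℕ) {m : ℕ} (ed : EdgeDataOn 2 m (baseHike (EX K)))
    (hed : IsEdgeDataOn CampaignW31.edgeDataProvenance (baseHike (EX K)) ed) (Ec : IdealExponent (Z K))
    (hcf : IsCoreFocus S04CharAlgebra.pAlg (invInst (baseHike (EX K)) ed) (baseHike (EX K)) Ec)
    (IsCoreFocusOf : IdealExponent (Z K) → IdealExponent (Z K) → Prop) (E : IdealExponent (Z K)) (hE : E.IsStandard)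
    (hEc : IsCoreFocusOf (baseHike E) Ec) (IsEdgeData' : (η : Z K) → EdgeDatumAt 2 n Ec η → Prop)
    (hR1 : ∀ η (D : EdgeDatumAt 2 n Ec η), IsEdgeData' η D → S04CharAlgebra.IsEdgeData D) :
    ¬ Thm6_14_1 (ambient K 2) n IsCoreFocusOf E Ec hE hEc IsEdgeData' :=
  not_Thm6_14_1_of_isCoreFocus K 2 n m (invInst (baseHike (EX K)) ed) (baseHike (EX K)) Ec (baseHike_b_pos K) hcf
    (closure_invmaxStratum_eq_C (baseHike_EX K) ed hed) IsCoreFocusOf E hE hEc IsEdgeData' hR1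

/-- The same with `IsCoreFocusOf := IsCoreFocus ℘ (invInst Ê_× ed)`, `E := E_×` and the Def. 4.9 reading itself (R1): the typed
Th. 6.14 (1) fails AT the located pair `(E_×, Ě)` for every typed core focus `Ě`. -/
theorem not_Thm6_14_1_EX (n : ℕ) {m : ℕ} (ed : EdgeDataOn 2 m (baseHike (EX K)))
    (hed : IsEdgeDataOn CampaignW31.edgeDataProvenance (baseHike (EX K)) ed) (Ec : IdealExponent (Z K))
    (hcf : IsCoreFocus S04CharAlgebra.pAlg (invInst (baseHike (EX K)) ed) (baseHike (EX K)) Ec) :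
    ¬ Thm6_14_1 (ambient K 2) n (IsCoreFocus S04CharAlgebra.pAlg (invInst (baseHike (EX K)) ed)) (EX K) Ec
        (isStandard_EX K) hcf (fun _ D => S04CharAlgebra.IsEdgeData D) :=
  not_Thm6_14_1_of_isCoreFocus_baseHike_EX K n ed hed Ec hcf _ (EX K) (isStandard_EX K) hcf _ fun _ _ h => h

/-- **THE INHABITANT (desk #98 (E2.iii); consumers R20/20a, R99/99a, R12)** — over every algebraically closed field of
characteristic `2` there is a STANDARD `E` on `𝔸³` with a certified Def. 4.9 edge-data family of `Ê` such that: `Σ̄_max(Ê)` is in the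
A-type class `LCIClass` but NOT regular (a singular l.c.i. cut), the typed `Ě` exists, and the typed Th. 6.14 (1) fails for every
typed core focus `Ě` of `Ê`, in every dimension parameter `n` and every edge-data reading implying Def. 4.9. -/
theorem crossSpecimen_inhabitant :
    ∃ (E : IdealExponent (Z K)) (hE : E.IsStandard) (ed : EdgeDataOn 2 3 (baseHike E)),
      IsEdgeDataOn CampaignW31.edgeDataProvenance (baseHike E) ed ∧
      CampaignW36.LCIClass (baseHike E)
        (invmaxStratum ((baseHike E).sing ∩ S02Preliminaries.closedPoints (Z K)) (invField (baseHike E) ed)) ∧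
      ¬ CampaignW31.InvmaxClosureRegularOn ((baseHike E).sing ∩ S02Preliminaries.closedPoints (Z K))
        (invField (baseHike E) ed) ∧
      (∃ Ec : IdealExponent (Z K), IsCoreFocus S04CharAlgebra.pAlg (invInst (baseHike E) ed) (baseHike E) Ec) ∧
      ∀ (Ec : IdealExponent (Z K)) (hEc : IsCoreFocus S04CharAlgebra.pAlg (invInst (baseHike E) ed) (baseHike E) Ec)
        (n : ℕ) (IsEdgeData' : (η : Z K) → EdgeDatumAt 2 n Ec η → Prop),
        (∀ η (D : EdgeDatumAt 2 n Ec η), IsEdgeData' η D → S04CharAlgebra.IsEdgeData D) →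
          ¬ Thm6_14_1 (ambient K 2) n (IsCoreFocus S04CharAlgebra.pAlg (invInst (baseHike E) ed)) E Ec hE hEc IsEdgeData' :=
  ⟨EX K, isStandard_EX K, edgeDataOn_of_eq (baseHike_EX K), isEdgeDataOn_edgeDataOn_of_eq (baseHike_EX K),
    lciClass_baseHike_EX K _ (isEdgeDataOn_edgeDataOn_of_eq (baseHike_EX K)),
    not_invmaxClosureRegularOn_baseHike_EX K _ (isEdgeDataOn_edgeDataOn_of_eq (baseHike_EX K)),
    exists_isCoreFocus_baseHike_EX K _ (isEdgeDataOn_edgeDataOn_of_eq (baseHike_EX K)),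
    fun Ec hEc n IsEdgeData' hR1 =>
      not_Thm6_14_1_of_isCoreFocus_baseHike_EX K n _ (isEdgeDataOn_edgeDataOn_of_eq (baseHike_EX K)) Ec hEc _
        (EX K) (isStandard_EX K) hEc IsEdgeData' hR1⟩

end Instance

/-- Non-vacuity of the field hypotheses: `K = \overline{𝔽_2}` qualifies. -/
example : ∃ (E : IdealExponent (Z (AlgebraicClosure (ZMod 2)))), E.IsStandard ∧
    ∃ ed : EdgeDataOn 2 3 (baseHike E), IsEdgeDataOn CampaignW31.edgeDataProvenance (baseHike E) ed ∧
      ∃ Ec, IsCoreFocus S04CharAlgebra.pAlg (invInst (baseHike E) ed) (baseHike E) Ec := by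
  haveI : Fact (Nat.Prime 2) := ⟨Nat.prime_two⟩
  obtain ⟨E, hE, ed, hed, -, -, hEc, -⟩ := crossSpecimen_inhabitant (AlgebraicClosure (ZMod 2))
  exact ⟨E, hE, ed, hed, hEc⟩

end CrossSpecimenW36

end Summit.ResolutionOfSingularities.ResolutionOfSingularities.Theorems

end
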